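import Summits.AtomisticToContinuum.BoseEinsteinCondensation.Theorems.BECCutLineWeakDisorderFlatModeFromLandscape
import Literature.MathematicalPhysics.QuantumManyBody.LiebYngvasonBoxBound
import Literature.MathematicalPhysics.QuantumManyBody.BoseGasCatStates
import HarnessLib

/-!
# Crux `LandscapeBound` (stmt-AtomisticToContinuum-9087): the landscape functional is unbounded on nonnegative trial states; the `∀ δ ∀ Ψ` reading is false

Negative lemmas of the standing disprover of crux `LandscapeBound` (route `BECCutLineWeakDisorder`,
rank 2), landed copy of § Unbounded of `Cruxes/LandscapeBound/Disproof.lean`; companion of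
`Negative/ConstantAtLeastOne.lean` (functional `≥ 1` everywhere). The crux asks for SOME nonnegative
`δ`-near-minimiser with `∫ L³ m(Y)²/s(Y)² dY ≤ C`; here we show why the existential cannot be
read universally without the energy doing real work:

* `div_volume_le_landscapeRatio` — if every slice `x ↦ Ψ(x, Y)` of an admissible state is
  supported in a measurable `S` with `0 < |S| < ∞`, then `L³/|S| ≤ ∫ L³ m²/s²` (Cauchy–Schwarz on
  the slice, `lintegral_slice_sq_le_of_support`, then `∫ m = 1`);
* `exists_nonneg_trialState_one` — a NONNEGATIVE one-particle Dirichlet state of every box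
  (`TrialState.nonempty_one` with the sign tracked);
* `exists_nonneg_landscapeRatio_ge` — for all `n` and `0 < ℓ ≤ L` a NONNEGATIVE
  `Ψ ∈ TrialState (n+1) L` (power of a bump of the corner sub-box `Λ_ℓ`) with functional
  `≥ L³/ℓ³`: at fixed `(n, L)` the functional is unbounded on nonnegative admissible states, in
  particular NOT controlled by `L²`-closeness (so `GroundStateRigidity` transfers occupations, as
  in the route's `closes`, never the ratio itself);
* `not_landscapeBound_forall_forall` — the reading `∀ δ > 0, ∀ Ψ` (every nonnegative
  `δ`-near-minimiser obeys the bound, for every slack) is FALSE: at `δ = ⊤` (admissible,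
  `δ : ℝ≥0∞`) near-minimality is vacuous and the sub-box power states of side `L/(C+1)` beat any
  `C` (witness `v = 0`). The honest universal form (`∃ δ > 0, ∀ Ψ`) is also expected to fail, by
  thin spikes on top of a near-minimiser (`δ/(ρw) → ∞`); that needs a `C¹` near-ground-state
  witness and is recorded as a near-miss in the work file.

No Theses statement is asserted positively; no `def`. All `[folklore]`.
-/

noncomputable section

open MeasureTheory Set Filter Metric
open scoped ENNReal NNReal

namespace Summit.AtomisticToContinuum.BoseEinsteinCondensation.Theorems.LandscapeBound.Negative

open Literature.MathematicalPhysics.QuantumManyBody.BoseGas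
open Summit.AtomisticToContinuum.BoseEinsteinCondensation.Theses.BECCutLineWeakDisorder
open Summit.AtomisticToContinuum.BoseEinsteinCondensation.Theorems.FlatModeFromLandscape

variable {n : ℕ} {L : ℝ}

/-- **Cauchy–Schwarz on a slice with prescribed support.** If every slice `x ↦ Ψ(x, Y)` vanishes
off a measurable set `S`, then `s(Y)² ≤ |S| · m(Y)`. [folklore] -/
theorem lintegral_slice_sq_le_of_support (Ψ : TrialState (n + 1) L) {S : Set Space}
    (hS : MeasurableSet S) (h0 : ∀ (Y : Config n) (x : Space), x ∉ S → Ψ.ψ (Matrix.vecCons x Y) = 0)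
    (Y : Config n) :
    (∫⁻ x, (‖Ψ.ψ (Matrix.vecCons x Y)‖₊ : ℝ≥0∞)) ^ 2 ≤
      volume S * ∫⁻ x, (‖Ψ.ψ (Matrix.vecCons x Y)‖₊ : ℝ≥0∞) ^ 2 := by
  have hΨm : Measurable Ψ.ψ := Ψ.contDiff.continuous.measurable
  have hg : Measurable fun x : Space => (‖Ψ.ψ (Matrix.vecCons x Y)‖₊ : ℝ≥0∞) :=
    (measurable_comp_vecCons_left hΨm Y).nnnorm.coe_nnreal_ennreal
  set f : Space → ℝ≥0∞ := S.indicator 1 with hf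
  have hfm : Measurable f := measurable_one.indicator hS
  have hfg : ∀ x, f x * (‖Ψ.ψ (Matrix.vecCons x Y)‖₊ : ℝ≥0∞) =
      (‖Ψ.ψ (Matrix.vecCons x Y)‖₊ : ℝ≥0∞) := by
    intro x
    by_cases hx : x ∈ S
    · simp [f, hx]
    · simp [f, hx, h0 Y x hx]
  have hf2 : ∫⁻ x, f x ^ 2 = volume S := by
    have : (fun x => f x ^ 2) = S.indicator 1 := by
      funext x; by_cases hx : x ∈ S <;> simp [f, hx]
    rw [this, lintegral_indicator_one hS]
  calc (∫⁻ x, (‖Ψ.ψ (Matrix.vecCons x Y)‖₊ : ℝ≥0∞)) ^ 2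
      = (∫⁻ x, f x * (‖Ψ.ψ (Matrix.vecCons x Y)‖₊ : ℝ≥0∞)) ^ 2 := by simp_rw [hfg]
    _ ≤ (∫⁻ x, f x ^ 2) * ∫⁻ x, (‖Ψ.ψ (Matrix.vecCons x Y)‖₊ : ℝ≥0∞) ^ 2 :=
        lintegral_mul_sq_le volume hfm.aemeasurable hg.aemeasurable
    _ = _ := by rw [hf2]

/-- **Support lower bound for the landscape functional.** If every slice of `Ψ` is supported in a
measurable set `S` with `0 < |S| < ∞`, then `L³ / |S| ≤ ∫ L³ m²/s²` (pointwise
`(L³/|S|) m ≤ L³ m²/s²` from `s² ≤ |S| m`, then `∫ m = 1`). A state whose slices live in a small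
set has a LARGE landscape functional. [folklore] -/
theorem div_volume_le_landscapeRatio (Ψ : TrialState (n + 1) L) {S : Set Space}
    (hS : MeasurableSet S) (h0 : ∀ (Y : Config n) (x : Space), x ∉ S → Ψ.ψ (Matrix.vecCons x Y) = 0)
    (hS0 : volume S ≠ 0) (hStop : volume S ≠ ⊤) :
    ENNReal.ofReal (L ^ 3) / volume S ≤ ∫⁻ Y : Config n, ENNReal.ofReal (L ^ 3) *
      (∫⁻ x, (‖Ψ.ψ (Matrix.vecCons x Y)‖₊ : ℝ≥0∞) ^ 2) ^ 2 /
        (∫⁻ x, (‖Ψ.ψ (Matrix.vecCons x Y)‖₊ : ℝ≥0∞)) ^ 2 := by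
  have hΨm : Measurable Ψ.ψ := Ψ.contDiff.continuous.measurable
  set A := ENNReal.ofReal (L ^ 3) with hA
  set V := volume S with hV
  have hpt : ∀ Y : Config n, A / V * ∫⁻ x, (‖Ψ.ψ (Matrix.vecCons x Y)‖₊ : ℝ≥0∞) ^ 2 ≤
      A * (∫⁻ x, (‖Ψ.ψ (Matrix.vecCons x Y)‖₊ : ℝ≥0∞) ^ 2) ^ 2 /
        (∫⁻ x, (‖Ψ.ψ (Matrix.vecCons x Y)‖₊ : ℝ≥0∞)) ^ 2 := by
    intro Y
    have hslice : Measurable fun x : Space => (‖Ψ.ψ (Matrix.vecCons x Y)‖₊ : ℝ≥0∞) :=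
      (measurable_comp_vecCons_left hΨm Y).nnnorm.coe_nnreal_ennreal
    set m := ∫⁻ x, (‖Ψ.ψ (Matrix.vecCons x Y)‖₊ : ℝ≥0∞) ^ 2 with hm
    set s := ∫⁻ x, (‖Ψ.ψ (Matrix.vecCons x Y)‖₊ : ℝ≥0∞) with hs
    by_cases h0s : s = 0
    · have hm0 : m = 0 := by
        have h1 := (lintegral_eq_zero_iff hslice).1 h0s
        refine (lintegral_eq_zero_iff (hslice.pow_const 2)).2 ?_
        filter_upwards [h1] with x hx
        simp only [Pi.zero_apply] at hx ⊢
        simp [hx]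
      rw [hm0, mul_zero]
      exact bot_le
    have hsfin : s ≠ ⊤ := (hasFiniteIntegral_iff_enorm.mp (integrable_slice Ψ Y).2).ne
    rw [ENNReal.le_div_iff_mul_le (Or.inl (pow_ne_zero 2 h0s)) (Or.inl (ENNReal.pow_ne_top hsfin))]
    calc A / V * m * s ^ 2 ≤ A / V * m * (V * m) := by
          gcongr
          exact lintegral_slice_sq_le_of_support Ψ hS h0 Y
      _ = A / V * V * m ^ 2 := by ring
      _ = A * m ^ 2 := by rw [ENNReal.div_mul_cancel hS0 hStop]
  calc A / V = A / V * ∫⁻ Y : Config n, ∫⁻ x, (‖Ψ.ψ (Matrix.vecCons x Y)‖₊ : ℝ≥0∞) ^ 2 := by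
        rw [lintegral_lintegral_sq_nnnorm_vecCons hΨm, Ψ.norm_eq, mul_one]
    _ = ∫⁻ Y : Config n, A / V * ∫⁻ x, (‖Ψ.ψ (Matrix.vecCons x Y)‖₊ : ℝ≥0∞) ^ 2 :=
        (lintegral_const_mul' _ _ (ENNReal.div_ne_top ENNReal.ofReal_ne_top hS0)).symm
    _ ≤ _ := lintegral_mono hpt

/-! ### Nonnegative product states concentrated in a sub-box -/

/-- A NONNEGATIVE one-particle Dirichlet state of the box `Λ_ℓ` (normalised smooth bump centred in
the box; the construction of `TrialState.nonempty_one` with the sign tracked). [folklore] -/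
theorem exists_nonneg_trialState_one {ℓ : ℝ} (hℓ : 0 < ℓ) :
    ∃ β : TrialState 1 ℓ, ∀ X, β.ψ X = (‖β.ψ X‖ : ℂ) := by
  let c : Config 1 := fun _ => WithLp.toLp 2 (fun _ : Fin 3 => ℓ / 2)
  let f : ContDiffBump c := ⟨ℓ / 8, ℓ / 4, by positivity, by linarith⟩
  set A : ℝ≥0∞ := ∫⁻ X, (‖f X‖₊ : ℝ≥0∞) ^ 2 with hA
  have hmeas : Measurable (fun X => (‖f X‖₊ : ℝ≥0∞) ^ 2) :=
    (f.continuous.measurable.nnnorm.coe_nnreal_ennreal).pow_const 2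
  have hAtop : A ≠ ⊤ := by
    have hint : Integrable (fun X => f X ^ 2) volume :=
      (f.continuous.pow 2).integrable_of_hasCompactSupport
        (f.hasCompactSupport.mul_left (f' := f))
    have := hint.2
    rw [HasFiniteIntegral] at this
    refine ne_top_of_le_ne_top this.ne (le_of_eq ?_)
    refine lintegral_congr fun X => ?_
    rw [enorm_pow]
    rfl
  have hA0 : A ≠ 0 := by
    have h1 : volume (closedBall c f.rIn) ≤ A := by
      calc volume (closedBall c f.rIn) = ∫⁻ X in closedBall c f.rIn, 1 := (setLIntegral_one _).symm
        _ = ∫⁻ X in closedBall c f.rIn, (‖f X‖₊ : ℝ≥0∞) ^ 2 := by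
            refine setLIntegral_congr_fun measurableSet_closedBall (fun X hX => ?_)
            rw [f.one_of_mem_closedBall hX]; simp
        _ ≤ A := setLIntegral_le_lintegral _ _
    have h2 : 0 < volume (closedBall c f.rIn) := measure_closedBall_pos volume c (by
      show 0 < ℓ / 8; positivity)
    exact (h2.trans_le h1).ne'
  let k : ℝ≥0 := NNReal.sqrt (A.toNNReal)⁻¹
  have hk : (k : ℝ≥0∞) ^ 2 * A = 1 := by
    rw [← ENNReal.coe_pow, NNReal.sq_sqrt, ENNReal.coe_inv (ENNReal.toNNReal_ne_zero.2 ⟨hA0, hAtop⟩),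
      ENNReal.coe_toNNReal hAtop, ENNReal.inv_mul_cancel hA0 hAtop]
  refine ⟨⟨fun X => (k : ℂ) * (f X : ℂ), ?_, ?_, ?_, ?_⟩, ?_⟩
  · exact contDiff_const.mul (Complex.ofRealCLM.contDiff.comp f.contDiff)
  · intro X hX
    suffices f X = 0 by simp [this]
    rw [← Function.notMem_support, f.support_eq]
    intro hball
    apply hX
    intro i j
    have h1 : dist (X i) (c i) < ℓ / 4 := (dist_le_pi_dist X c i).trans_lt hball
    have h2 : dist (X i j) (ℓ / 2) < ℓ / 4 := (PiLp.dist_apply_le (X i) (c i) j).trans_lt h1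
    rw [Real.dist_eq, abs_lt] at h2
    constructor <;> linarith [h2.1, h2.2]
  · intro σ X
    rw [Subsingleton.elim σ 1, Equiv.Perm.coe_one, Function.comp_id]
  · have : ∀ X, (‖(k : ℂ) * (f X : ℂ)‖₊ : ℝ≥0∞) ^ 2 = (k : ℝ≥0∞) ^ 2 * (‖f X‖₊ : ℝ≥0∞) ^ 2 := by
      intro X
      rw [nnnorm_mul, ENNReal.coe_mul, mul_pow]
      congr 2
      · simp
      · rw [Complex.nnnorm_real]
    simp_rw [this]
    rw [lintegral_const_mul _ hmeas, hk]
  · intro X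
    show (k : ℂ) * (f X : ℂ) = (‖(k : ℂ) * (f X : ℂ)‖ : ℂ)
    rw [norm_mul, Complex.norm_real, Complex.norm_real, Real.norm_of_nonneg k.coe_nonneg,
      Real.norm_of_nonneg (f.nonneg' X)]
    push_cast
    rfl

/-- `Λ_ℓ ⊆ Λ_L` for `ℓ ≤ L`. [folklore] -/
theorem box_subset_box {ℓ L : ℝ} (h : ℓ ≤ L) : box ℓ ⊆ box L :=
  fun _ hx k => ⟨(hx k).1, (hx k).2.trans_le h⟩

/-- The power of a nonnegative mode is nonnegative. [folklore] -/
theorem powFun_nonneg {u : Space → ℂ} (hu : ∀ x, u x = (‖u x‖ : ℂ)) (N : ℕ) (X : Config N) :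
    powFun u N X = (‖powFun u N X‖ : ℂ) := by
  unfold powFun
  rw [norm_prod, Complex.ofReal_prod]
  exact Finset.prod_congr rfl fun i _ => hu (X i)

/-- **Nonnegative trial states with arbitrarily large landscape functional.** For every `n`,
`0 < ℓ ≤ L` there is a NONNEGATIVE `Ψ ∈ TrialState (n+1) L` (the `(n+1)`-fold power of a
nonnegative bump of the corner sub-box `Λ_ℓ ⊆ Λ_L`) with `∫ L³ m²/s² ≥ L³/ℓ³`. So at fixed
`(n, L)` the landscape functional is unbounded above on nonnegative admissible states: it is not
controlled by the `L²` class, and any `∀ Ψ` reading of the crux needs the energy constraint to do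
real work. [folklore] -/
theorem exists_nonneg_landscapeRatio_ge (n : ℕ) {ℓ L : ℝ} (hℓ : 0 < ℓ) (hℓL : ℓ ≤ L) :
    ∃ Ψ : TrialState (n + 1) L, (∀ X, Ψ.ψ X = (‖Ψ.ψ X‖ : ℂ)) ∧
      ENNReal.ofReal (L ^ 3) / ENNReal.ofReal (ℓ ^ 3) ≤ ∫⁻ Y : Config n, ENNReal.ofReal (L ^ 3) *
        (∫⁻ x, (‖Ψ.ψ (Matrix.vecCons x Y)‖₊ : ℝ≥0∞) ^ 2) ^ 2 /
          (∫⁻ x, (‖Ψ.ψ (Matrix.vecCons x Y)‖₊ : ℝ≥0∞)) ^ 2 := by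
  obtain ⟨β, hβ⟩ := exists_nonneg_trialState_one hℓ
  -- the one-body mode of `β` and its power
  set u : Space → ℂ := fun x => β.ψ fun _ => x with hu
  have hone : oneFun u = β.ψ := funext fun Y => congrArg β.ψ (const_apply_zero_eq Y)
  have hu0 : ∀ x, x ∉ box ℓ → u x = 0 := fun x hx => β.eq_zero _ (by simpa [boxN] using hx)
  have hcd : ContDiff ℝ 1 (oneFun u) := by rw [hone]; exact β.contDiff
  let Ψ : TrialState (n + 1) L :=
    { ψ := powFun u (n + 1)
      contDiff := contDiff_powFun hcd (n + 1)
      eq_zero := fun X hX => by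
        have : ∃ i, X i ∉ box L := by simpa [boxN] using hX
        obtain ⟨i, hi⟩ := this
        exact powFun_eq_zero_of_exists _ ⟨i, hu0 _ fun h => hi (box_subset_box hℓL h)⟩
      symm := fun σ X => powFun_comp_perm _ σ X
      norm_eq := lintegral_powFun_sq hcd (by rw [hone]; exact β.norm_eq) (n + 1) }
  refine ⟨Ψ, fun X => powFun_nonneg (u := u) (fun x => hβ fun _ => x) (n + 1) X, ?_⟩
  have hvol : volume (box ℓ) = ENNReal.ofReal (ℓ ^ 3) := by
    rw [volume_box, ENNReal.ofReal_pow hℓ.le]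
  rw [← hvol]
  refine div_volume_le_landscapeRatio _ (measurableSet_box ℓ) (fun Y x hx => ?_) ?_ ?_
  · show powFun u (n + 1) (Matrix.vecCons x Y) = 0
    rw [powFun_vecCons, hu0 x hx, zero_mul]
  · rw [hvol]; exact (ENNReal.ofReal_pos.2 (by positivity)).ne'
  · rw [hvol]; exact ENNReal.ofReal_ne_top

/-- **The `∀ δ, ∀ Ψ` reading of the crux is false.** Replacing `∀ δ > 0, ∃ Ψ` by `∀ δ > 0, ∀ Ψ`
(every nonnegative `δ`-near-minimiser obeys the bound, for every slack) fails already at `δ = ⊤`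
(allowed: `δ : ℝ≥0∞`), where near-minimality is vacuous: nonnegative product bumps in a sub-box of
side `L/(C+1)` have landscape functional `≥ (C+1)³ > C` (witness `v = 0`). [folklore] -/
theorem not_landscapeBound_forall_forall :
    ¬ ∀ v : ℝ → ℝ≥0∞, IsRepulsiveFiniteRange v → ∃ ρ₀ : ℝ, 0 < ρ₀ ∧ ∀ ρ : ℝ, 0 < ρ → ρ < ρ₀ →
      ∃ C : ℝ, 0 < C ∧ ∀ᶠ n : ℕ in atTop, ∀ δ : ℝ≥0∞, 0 < δ →
        ∀ Ψ : TrialState (n + 1) (sideLength ρ (n + 1)),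
          energy v Ψ ≤ groundStateEnergy v (n + 1) (sideLength ρ (n + 1)) + δ →
          (∀ X, Ψ.ψ X = (‖Ψ.ψ X‖ : ℂ)) →
          ∫⁻ Y : Config n, ENNReal.ofReal (sideLength ρ (n + 1) ^ 3) *
              (∫⁻ x, (‖Ψ.ψ (Matrix.vecCons x Y)‖₊ : ℝ≥0∞) ^ 2) ^ 2 /
                (∫⁻ x, (‖Ψ.ψ (Matrix.vecCons x Y)‖₊ : ℝ≥0∞)) ^ 2 ≤ ENNReal.ofReal C := by
  intro h
  obtain ⟨ρ₀, hρ₀, H⟩ := h 0 ⟨measurable_const, ⟨0, fun _ _ => rfl⟩⟩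
  obtain ⟨C, hC, hev⟩ := H (ρ₀ / 2) (by positivity) (by linarith)
  obtain ⟨n, hn⟩ := hev.exists
  set L := sideLength (ρ₀ / 2) (n + 1) with hL
  have hLpos : 0 < L := Real.rpow_pos_of_pos (div_pos (Nat.cast_pos.mpr n.succ_pos) (by positivity)) _
  have hC1 : 1 ≤ C + 1 := by linarith
  have hℓ : 0 < L / (C + 1) := by positivity
  have hℓL : L / (C + 1) ≤ L := div_le_self hLpos.le hC1
  obtain ⟨Ψ, hΨ, hge⟩ := exists_nonneg_landscapeRatio_ge n hℓ hℓL
  have hbd := hn ⊤ (by simp) Ψ (by simp) hΨ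
  have key : ENNReal.ofReal ((C + 1) ^ 3) ≤ ENNReal.ofReal C := by
    refine le_trans ?_ (hge.trans hbd)
    rw [← ENNReal.ofReal_div_of_pos (by positivity)]
    refine ENNReal.ofReal_le_ofReal (le_of_eq ?_)
    field_simp
  rw [ENNReal.ofReal_le_ofReal_iff hC.le] at key
  have h3 : C + 1 ≤ (C + 1) ^ 3 := le_self_pow₀ hC1 (by norm_num)
  linarith

end Summit.AtomisticToContinuum.BoseEinsteinCondensation.Theorems.LandscapeBound.Negative

end
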